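import Mathlib
import Literature.Probability.Process.PointStationaryLaw
import Summits.AtomisticToContinuum.Crystallization.Theorems.PalmUnimodularRigidityUnimodularEnergyLowerBoundHardCore
import Summits.AtomisticToContinuum.Crystallization.Theorems.ChargedEnergyGap.Negative.FarCopies
import HarnessLib

/-!
# Mass transport through ball centres for point-stationary hard-core laws

Support file for item `stmt-AtomisticToContinuum-9229` (`UnimodularEnergyLowerBound`, route
`PalmUnimodularRigidity`).  The MASS-TRANSPORT PRINCIPLE in the form used to prove `e_uni ≥ e*`,
together with the measurability device it needs.

## Part 1 — an s-finite kernel that is the identity on hard-core configurations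

Mass-transport arguments for point-stationary laws `P : Measure (Measure ℝ³)` need functionals such
as `(μ, v) ↦ μ (ball v R)` or `(μ, v) ↦ ∫ 1_{ball v R}ᶜ f dμ` to be JOINTLY measurable in the
configuration `μ` (Giry σ-algebra) and a space variable `v`.  Mathlib provides this for s-finite
KERNELS (`Kernel.measurable_kernel_prodMk_left`, `Measurable.lintegral_kernel_prod_right`), but the
identity map of `Measure ℝ³` is not an s-finite kernel.  We therefore replace `μ` by `κ μ`, where
`κ` is an s-finite kernel that coincides with the identity on the configurations the law charges:
`exists_kernel_eq_self` (cut `ℝ³` into the shells `⌊‖z‖⌋ = n`; on each shell keep `μ` only if its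
mass there is at most the packing bound `(2(n+1)/δ + 1)³`, else `0`; sum over `n`), and the joint
measurability statements `measurable_kernel_ball`, `measurable_setLIntegral_kernel_compl_ball`.

## Part 2 — the transport

Let `P` be a point-stationary law (`IsPointStationaryLaw`, the Mecke identity) carried by rooted
`δ`-hard-core configurations `μ = count|S` of `ℝ³`, and let `F(μ, v) ≥ 0` be a jointly measurable
"payload" depending on the configuration and on a ball centre `v`.  The root sends, to every point
`y` of its configuration, the mass `∫_{B(0,R) ∩ B(y,R)} F(μ, v) / #(S ∩ B(v,R)) dv` — it spreads
over the centres `v` of the `R`-balls containing it, and each centre splits the payload evenly among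
the configuration points in its ball.  This transport is translation-covariant with no external
randomness, so the Mecke identity applies, and computing both sides gives
(`lintegral_mass_transport_ball`)

`E_P ∫_{B(0,R)} F(μ, v) dv = E_P ∫_{B(0,R)} (1/#(S ∩ B(v,R))) Σ_{y ∈ S ∩ B(v,R)} F(θ_y μ, v - y) dv`,

`θ_y μ = μ.map (· - y)` the configuration re-rooted at `y`.  "Mass sent = mass received"; the right
side averages the payload over the points of a COMMON ball, which is what makes cluster (finite
configuration) energy inequalities applicable under `P`.  Ingredients: the swap lemma
`lintegral_lintegral_indicator_ball_div` (sum over points × integral over centres) and the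
re-rooting change of variables `lintegral_indicator_map_sub`.

All `[folklore]` (Aldous–Lyons mass-transport principle / Mecke identity bookkeeping).
-/

noncomputable section

namespace Summit.AtomisticToContinuum.Crystallization.Theorems.UnimodularEnergy

open MeasureTheory Metric Set Filter ProbabilityTheory
open scoped ENNReal Topology
open Literature.Probability.Process
open Summit.AtomisticToContinuum.Crystallization.Theorems.ChargedEnergyGapNegative (E3)

/-! ### Joint measurability for s-finite kernels -/

section Measurable

variable {α : Type*} [MeasurableSpace α] (κ : Kernel α E3) [IsSFiniteKernel κ]

/-- For an s-finite kernel `κ`, `(a, v) ↦ κ a (ball v R)` is jointly measurable. [folklore] -/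
theorem measurable_kernel_ball (R : ℝ) :
    Measurable fun p : α × E3 => κ p.1 (ball p.2 R) := by
  have ht : MeasurableSet {q : (α × E3) × E3 | dist q.2 q.1.2 < R} :=
    measurableSet_lt (measurable_snd.dist measurable_fst.snd) measurable_const
  exact Kernel.measurable_kernel_prodMk_left (κ := Kernel.prodMkRight E3 κ) ht

/-- For an s-finite kernel `κ` and measurable `f ≥ 0`, `(a, v) ↦ ∫⁻ z in (ball v R)ᶜ, f z ∂(κ a)`
is jointly measurable. [folklore] -/
theorem measurable_setLIntegral_kernel_compl_ball {f : E3 → ℝ≥0∞} (hf : Measurable f) (R : ℝ) :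
    Measurable fun p : α × E3 => ∫⁻ z in (ball p.2 R)ᶜ, f z ∂(κ p.1) := by
  have hset : MeasurableSet {q : (α × E3) × E3 | q.2 ∉ ball q.1.2 R} :=
    (measurableSet_lt (measurable_snd.dist measurable_fst.snd) measurable_const).compl
  have hg : Measurable
      (Function.uncurry fun (p : α × E3) (z : E3) => (ball p.2 R)ᶜ.indicator f z) := by
    have : (Function.uncurry fun (p : α × E3) (z : E3) => (ball p.2 R)ᶜ.indicator f z) =
        {q : (α × E3) × E3 | q.2 ∉ ball q.1.2 R}.indicator fun q => f q.2 := by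
      funext q
      show (ball q.1.2 R)ᶜ.indicator f q.2 =
        {q : (α × E3) × E3 | q.2 ∉ ball q.1.2 R}.indicator (fun q => f q.2) q
      by_cases h : q.2 ∈ ball q.1.2 R
      · have h1 : q.2 ∉ (ball q.1.2 R)ᶜ := fun h' => h' h
        have h2 : q ∉ {q : (α × E3) × E3 | q.2 ∉ ball q.1.2 R} := fun h' => h' h
        rw [Set.indicator_of_notMem h1, Set.indicator_of_notMem h2]
      · have h1 : q.2 ∈ (ball q.1.2 R)ᶜ := h
        have h2 : q ∈ {q : (α × E3) × E3 | q.2 ∉ ball q.1.2 R} := h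
        rw [Set.indicator_of_mem h1, Set.indicator_of_mem h2]
    rw [this]
    exact (hf.comp measurable_snd).indicator hset
  have h := Measurable.lintegral_kernel_prod_right (κ := Kernel.prodMkRight E3 κ) hg
  have heq : (fun p : α × E3 => ∫⁻ z in (ball p.2 R)ᶜ, f z ∂(κ p.1)) =
      fun p => ∫⁻ z, (ball p.2 R)ᶜ.indicator f z ∂(Kernel.prodMkRight E3 κ p) := by
    funext p
    rw [Kernel.prodMkRight_apply, lintegral_indicator measurableSet_ball.compl]
  rw [heq]
  exact h

end Measurable

/-! ### The truncated identity kernel -/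

section Kernel

variable {δ : ℝ}

/-- Packing bound for the counting measure of a `δ`-separated set on a closed ball:
`count|S (closedBall 0 r) ≤ (2r/δ + 1)³`. [folklore] -/
theorem count_restrict_closedBall_le (hδ : 0 < δ) {S : Set E3}
    (hsep : ∀ x ∈ S, ∀ y ∈ S, x ≠ y → δ ≤ dist x y) {r : ℝ} (hr : 0 ≤ r) :
    (Measure.count : Measure E3).restrict S (closedBall 0 r) ≤
      ENNReal.ofReal ((2 * r / δ + 1) ^ 3) := by
  have hfin : (closedBall (0 : E3) r ∩ S).Finite := by
    rw [inter_comm]; exact finite_inter_closedBall hδ hsep 0 r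
  rw [Measure.restrict_apply measurableSet_closedBall, Measure.count_apply_finite _ hfin,
    ← ENNReal.ofReal_natCast]
  refine ENNReal.ofReal_le_ofReal (card_le_of_subset_closedBall (p := 0) hδ hsep hr _ ?_)
  rw [Finite.coe_toFinset, inter_comm]

/-- **The truncated identity kernel.** For `δ > 0` there is an s-finite kernel `κ` on `Measure ℝ³`
with `κ μ = μ` for every rooted `δ`-hard-core configuration `μ`. [folklore] -/
theorem exists_kernel_eq_self (hδ : 0 < δ) :
    ∃ κ : Kernel (Measure E3) E3, IsSFiniteKernel κ ∧
      ∀ μ : Measure E3, IsRootedHardCore δ μ → κ μ = μ := by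
  classical
  -- the shells `⌊‖z‖⌋₊ = n`
  let A : ℕ → Set E3 := fun n => (fun z : E3 => ⌊‖z‖⌋₊) ⁻¹' {n}
  have hAm : ∀ n, MeasurableSet (A n) := fun n =>
    (Nat.measurable_floor.comp measurable_norm) (measurableSet_singleton n)
  have hAdisj : Pairwise (Function.onFun Disjoint A) := fun i j hij =>
    Set.disjoint_iff.2 fun z hz => hij (hz.1.symm.trans hz.2)
  have hAcov : (⋃ n, A n) = univ := iUnion_eq_univ_iff.2 fun z => ⟨_, rfl⟩
  have hAball : ∀ n, A n ⊆ closedBall 0 ((n : ℝ) + 1) := fun n z hz => by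
    have hz' : ⌊‖z‖⌋₊ = n := hz
    rw [mem_closedBall, dist_zero_right, ← hz']
    exact (Nat.lt_floor_add_one ‖z‖).le
  -- the bounds
  let M : ℕ → ℝ≥0∞ := fun n => ENNReal.ofReal ((2 * ((n : ℝ) + 1) / δ + 1) ^ 3)
  -- the finite pieces
  let κs : ℕ → Kernel (Measure E3) E3 := fun n =>
    { toFun := fun μ => if μ (A n) ≤ M n then μ.restrict (A n) else 0
      measurable' := by
        refine Measure.measurable_of_measurable_coe _ fun s hs => ?_
        have : (fun μ : Measure E3 => (if μ (A n) ≤ M n then μ.restrict (A n) else 0) s) =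
            fun μ => if μ (A n) ≤ M n then μ (s ∩ A n) else 0 := by
          funext μ
          split_ifs <;> simp [Measure.restrict_apply hs]
        rw [this]
        exact Measurable.ite ((Measure.measurable_coe (hAm n)) measurableSet_Iic)
          (Measure.measurable_coe (hs.inter (hAm n))) measurable_const }
  have hκs_apply : ∀ n (μ : Measure E3),
      κs n μ = if μ (A n) ≤ M n then μ.restrict (A n) else 0 := fun n μ => rfl
  have hfin : ∀ n, IsFiniteKernel (κs n) := fun n => by
    refine ⟨⟨M n, ENNReal.ofReal_lt_top, fun μ => ?_⟩⟩
    rw [hκs_apply]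
    split_ifs with h
    · rw [Measure.restrict_apply_univ]; exact h
    · simp
  refine ⟨Kernel.sum κs, inferInstance, fun μ hμ => ?_⟩
  obtain ⟨S, h0, hsep, rfl⟩ := hμ
  have hle : ∀ n, (Measure.count : Measure E3).restrict S (A n) ≤ M n := fun n =>
    (measure_mono (hAball n)).trans (count_restrict_closedBall_le hδ hsep (by positivity))
  rw [Kernel.sum_apply]
  have : (fun n => κs n ((Measure.count : Measure E3).restrict S)) =
      fun n => ((Measure.count : Measure E3).restrict S).restrict (A n) := by
    funext n
    rw [hκs_apply, if_pos (hle n)]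
  rw [this, ← Measure.restrict_iUnion hAdisj hAm, hAcov, Measure.restrict_univ]

end Kernel

/-! ### Measurability of `v ↦ count|S (ball v R)` -/

section CountBall

variable {δ : ℝ} {S : Set E3}

/-- For countable `S`, `v ↦ count|S (ball v R)` is measurable (a countable sum of indicators).
[folklore] -/
theorem measurable_count_restrict_ball (hS : S.Countable) (R : ℝ) :
    Measurable fun v : E3 => (Measure.count : Measure E3).restrict S (ball v R) := by
  haveI := hS.to_subtype
  have h : (fun v : E3 => (Measure.count : Measure E3).restrict S (ball v R)) =
      fun v => ∑' y : S, (ball (y : E3) R).indicator (fun _ => (1 : ℝ≥0∞)) v := by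
    funext v
    rw [← lintegral_indicator_one measurableSet_ball, lintegral_count_restrict hS]
    refine tsum_congr fun y => ?_
    by_cases hy : (y : E3) ∈ ball v R
    · rw [Set.indicator_of_mem hy, Set.indicator_of_mem (mem_ball_comm.1 hy)]
      rfl
    · rw [Set.indicator_of_notMem hy, Set.indicator_of_notMem (fun h => hy (mem_ball_comm.1 h))]
  rw [h]
  exact Measurable.tsum fun y => measurable_one.indicator measurableSet_ball

end CountBall

/-! ### The swap lemma: points × ball centres -/

section Swap

variable {δ : ℝ} {S : Set E3}

/-- **Swap lemma.** For a `δ`-separated `S` and payloads `G y v ≥ 0` (measurable in the centre `v`),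
summing over the points `y ∈ S` the integral over the centres `v ∈ B(0,R) ∩ B(y,R)` of
`G y v / #(S ∩ B(v,R))` equals the integral over `v ∈ B(0,R)` of the AVERAGE of `G · v` over the
points of `S ∩ B(v,R)`. [folklore] -/
theorem lintegral_lintegral_indicator_ball_div (hδ : 0 < δ)
    (hsep : ∀ x ∈ S, ∀ y ∈ S, x ≠ y → δ ≤ dist x y) (R : ℝ)
    {G : E3 → E3 → ℝ≥0∞} (hG : ∀ y, Measurable (G y)) :
    ∫⁻ y, (∫⁻ v, (ball (0 : E3) R ∩ ball y R).indicator
        (fun v => G y v / (Measure.count : Measure E3).restrict S (ball v R)) v)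
        ∂((Measure.count : Measure E3).restrict S) =
      ∫⁻ v in ball (0 : E3) R, (∫⁻ y in ball v R, G y v ∂((Measure.count : Measure E3).restrict S)) /
        (Measure.count : Measure E3).restrict S (ball v R) := by
  have hS : S.Countable := countable_of_separated hδ hsep
  haveI := hS.to_subtype
  set μ : Measure E3 := (Measure.count : Measure E3).restrict S with hμ
  have hN : Measurable fun v : E3 => μ (ball v R) := measurable_count_restrict_ball hS R
  -- measurability of the integrands in `v`
  have hI : ∀ y : E3, Measurable fun v =>
      (ball (0 : E3) R ∩ ball y R).indicator (fun v => G y v / μ (ball v R)) v := fun y =>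
    ((hG y).div hN).indicator (measurableSet_ball.inter measurableSet_ball)
  -- sum over points, then swap with the integral over centres
  rw [lintegral_count_restrict hS, ← lintegral_tsum fun y : S => (hI y).aemeasurable,
    ← lintegral_indicator measurableSet_ball]
  refine lintegral_congr fun v => ?_
  -- pointwise in `v`
  by_cases hv : v ∈ ball (0 : E3) R
  · rw [Set.indicator_of_mem hv]
    have h1 : ∀ y : S, (ball (0 : E3) R ∩ ball (y : E3) R).indicator
        (fun v => G y v / μ (ball v R)) v =
        (ball v R).indicator (fun z => G z v) y * (μ (ball v R))⁻¹ := fun y => by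
      by_cases hy : (y : E3) ∈ ball v R
      · have hv' : v ∈ ball (0 : E3) R ∩ ball (y : E3) R := ⟨hv, by rw [mem_ball, dist_comm]; exact hy⟩
        rw [Set.indicator_of_mem hv', Set.indicator_of_mem hy, div_eq_mul_inv]
      · have hv' : v ∉ ball (0 : E3) R ∩ ball (y : E3) R := fun h => hy (by
          rw [mem_ball, dist_comm]; exact h.2)
        rw [Set.indicator_of_notMem hv', Set.indicator_of_notMem hy, zero_mul]
    simp_rw [h1, ENNReal.tsum_mul_right, ← div_eq_mul_inv]
    congr 1
    rw [← lintegral_indicator measurableSet_ball, lintegral_count_restrict hS]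
  · rw [Set.indicator_of_notMem hv]
    refine ENNReal.tsum_eq_zero.2 fun y => ?_
    exact Set.indicator_of_notMem (fun h => hv h.1) _

/-- **Mass sent.** With a payload not depending on the receiving point, the swap lemma collapses:
the root sends `∫_{B(0,R)} F(v) dv` in total (each centre `v ∈ B(0,R)` has the root in its ball,
so the normalisation is a positive finite integer). [folklore] -/
theorem lintegral_lintegral_indicator_ball_div_const (hδ : 0 < δ) (h0 : (0 : E3) ∈ S)
    (hsep : ∀ x ∈ S, ∀ y ∈ S, x ≠ y → δ ≤ dist x y) (R : ℝ)
    {F : E3 → ℝ≥0∞} (hF : Measurable F) :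
    ∫⁻ y, (∫⁻ v, (ball (0 : E3) R ∩ ball y R).indicator
        (fun v => F v / (Measure.count : Measure E3).restrict S (ball v R)) v)
        ∂((Measure.count : Measure E3).restrict S) =
      ∫⁻ v in ball (0 : E3) R, F v := by
  rw [lintegral_lintegral_indicator_ball_div hδ hsep R (G := fun _ v => F v) fun _ => hF]
  refine setLIntegral_congr_fun measurableSet_ball fun v hv => ?_
  rw [setLIntegral_const, ENNReal.mul_div_cancel_right]
  · exact count_restrict_ball_ne_zero h0 (by rw [mem_ball, dist_comm]; exact hv)
  · exact count_restrict_ball_ne_top hδ hsep v R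

end Swap

/-! ### Re-rooting: the change of variables `v ↦ v - y` -/

section Reroot

/-- Re-rooting at `y` shifts balls: `(θ_y μ)(B(v,R)) = μ (B(v + y, R))`. [folklore] -/
theorem map_sub_apply_ball (μ : Measure E3) (y v : E3) (R : ℝ) :
    μ.map (fun z => z - y) (ball v R) = μ (ball (v + y) R) := by
  rw [Measure.map_apply (measurable_sub_const y) measurableSet_ball]
  congr 1
  ext z
  simp only [mem_preimage, mem_ball]
  rw [← dist_sub_right z (v + y) y, add_sub_cancel_right]

/-- **Mass received from `y`, recentred.** The mass the root receives from its point `y` (the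
transport evaluated at the configuration re-rooted at `y`, with the old root at `-y`) rewritten, by
the change of variables `v ↦ v - y` in the integral over centres, as an integral over the centres
`v ∈ B(0,R) ∩ B(y,R)` of the ORIGINAL configuration. [folklore] -/
theorem lintegral_indicator_map_sub (μ : Measure E3) (y : E3) (R : ℝ)
    (F : Measure E3 → E3 → ℝ≥0∞) :
    ∫⁻ v, (ball (0 : E3) R ∩ ball (-y) R).indicator
        (fun v => F (μ.map fun z => z - y) v / μ.map (fun z => z - y) (ball v R)) v =
      ∫⁻ v, (ball (0 : E3) R ∩ ball y R).indicator
        (fun v => F (μ.map fun z => z - y) (v - y) / μ (ball v R)) v := by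
  rw [← lintegral_sub_right_eq_self _ y]
  refine lintegral_congr fun v => ?_
  have hmem : v - y ∈ ball (0 : E3) R ∩ ball (-y) R ↔ v ∈ ball (0 : E3) R ∩ ball y R := by
    simp only [mem_inter_iff, mem_ball, dist_eq_norm, sub_neg_eq_add, sub_add_cancel, sub_zero]
    exact and_comm
  by_cases hv : v ∈ ball (0 : E3) R ∩ ball y R
  · rw [Set.indicator_of_mem (hmem.2 hv), Set.indicator_of_mem hv, map_sub_apply_ball,
      sub_add_cancel]
  · rw [Set.indicator_of_notMem (fun h => hv (hmem.1 h)), Set.indicator_of_notMem hv]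

end Reroot

/-! ### The mass-transport identity through ball centres -/

section Transport

variable {δ : ℝ} {P : Measure (Measure E3)}

/-- **Mass transport through ball centres.** For a point-stationary law `P` carried by rooted
`δ`-hard-core configurations of `ℝ³`, an s-finite kernel `κ` that is the identity on those
configurations, a radius `R` and a jointly measurable payload `F ≥ 0`:
`E_P ∫_{B(0,R)} F(μ,v) dv = E_P ∫_{B(0,R)} (∫_{B(v,R)} F(θ_y μ, v - y) dμ(y)) / μ(B(v,R)) dv`.
[folklore] -/
theorem lintegral_mass_transport_ball (hδ : 0 < δ) (κ : Kernel (Measure E3) E3)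
    [IsSFiniteKernel κ] (hκ : ∀ μ : Measure E3, IsRootedHardCore δ μ → κ μ = μ)
    (hcore : ∀ᵐ μ ∂P, IsRootedHardCore δ μ) (hstat : IsPointStationaryLaw P) (R : ℝ)
    {F : Measure E3 → E3 → ℝ≥0∞} (hF : Measurable (Function.uncurry F)) :
    ∫⁻ μ, (∫⁻ v in ball (0 : E3) R, F μ v) ∂P =
      ∫⁻ μ, (∫⁻ v in ball (0 : E3) R,
        (∫⁻ y in ball v R, F (μ.map fun z => z - y) (v - y) ∂μ) / μ (ball v R)) ∂P := by
  -- the transport: mass sent by the root of `μ` to its point `y`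
  set g : Measure E3 → E3 → ℝ≥0∞ := fun μ y =>
    ∫⁻ v, (ball (0 : E3) R ∩ ball y R).indicator (fun v => F μ v / κ μ (ball v R)) v with hg_def
  -- joint measurability
  have hg : Measurable (Function.uncurry g) := by
    have hT : MeasurableSet {q : (Measure E3 × E3) × E3 | q.2 ∈ ball (0 : E3) R ∩ ball q.1.2 R} :=
      (measurableSet_lt (measurable_snd.dist measurable_const) measurable_const).inter
        (measurableSet_lt (measurable_snd.dist measurable_fst.snd) measurable_const)
    have hpr : Measurable fun q : (Measure E3 × E3) × E3 => (q.1.1, q.2) :=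
      measurable_fst.fst.prodMk measurable_snd
    have hf3 : Measurable fun q : (Measure E3 × E3) × E3 =>
        (ball (0 : E3) R ∩ ball q.1.2 R).indicator (fun v => F q.1.1 v / κ q.1.1 (ball v R)) q.2 := by
      have : (fun q : (Measure E3 × E3) × E3 =>
          (ball (0 : E3) R ∩ ball q.1.2 R).indicator (fun v => F q.1.1 v / κ q.1.1 (ball v R)) q.2) =
          {q : (Measure E3 × E3) × E3 | q.2 ∈ ball (0 : E3) R ∩ ball q.1.2 R}.indicator
            fun q => F q.1.1 q.2 / κ q.1.1 (ball q.2 R) := by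
        funext q
        by_cases h : q.2 ∈ ball (0 : E3) R ∩ ball q.1.2 R
        · have h2 : q ∈ {q : (Measure E3 × E3) × E3 | q.2 ∈ ball (0 : E3) R ∩ ball q.1.2 R} := h
          rw [Set.indicator_of_mem h, Set.indicator_of_mem h2]
        · have h2 : q ∉ {q : (Measure E3 × E3) × E3 | q.2 ∈ ball (0 : E3) R ∩ ball q.1.2 R} := h
          rw [Set.indicator_of_notMem h, Set.indicator_of_notMem h2]
      rw [this]
      exact ((hF.comp hpr).div ((measurable_kernel_ball κ R).comp hpr)).indicator hT
    exact hf3.lintegral_prod_right'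
  have key := hstat g hg
  -- mass sent
  have hsent : ∀ μ : Measure E3, IsRootedHardCore δ μ →
      ∫⁻ y, g μ y ∂μ = ∫⁻ v in ball (0 : E3) R, F μ v := by
    intro μ hμ
    have hκμ := hκ μ hμ
    obtain ⟨S, h0, hsep, rfl⟩ := hμ
    simp only [hg_def, hκμ]
    exact lintegral_lintegral_indicator_ball_div_const hδ h0 hsep R
      (hF.comp measurable_prodMk_left)
  -- mass received
  have hrec : ∀ μ : Measure E3, IsRootedHardCore δ μ →
      ∫⁻ y, g (μ.map fun z => z - y) (-y) ∂μ = ∫⁻ v in ball (0 : E3) R,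
        (∫⁻ y in ball v R, F (μ.map fun z => z - y) (v - y) ∂μ) / μ (ball v R) := by
    intro μ hμ
    have hμ' := hμ
    obtain ⟨S, h0, hsep, rfl⟩ := hμ
    have hS : S.Countable := countable_of_separated hδ hsep
    have hae : ∀ᵐ y ∂((Measure.count : Measure E3).restrict S),
        g (((Measure.count : Measure E3).restrict S).map fun z => z - y) (-y) =
          ∫⁻ v, (ball (0 : E3) R ∩ ball y R).indicator (fun v =>
            F (((Measure.count : Measure E3).restrict S).map fun z => z - y) (v - y) /
              (Measure.count : Measure E3).restrict S (ball v R)) v := by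
      refine (ae_mem_count_restrict hS).mono fun y hy => ?_
      have hy' : (Measure.count : Measure E3).restrict S {y} ≠ 0 :=
        (count_restrict_singleton_ne_zero_iff S y).2 hy
      have hκy := hκ _ (hμ'.map_sub hy')
      simp only [hg_def, hκy]
      exact lintegral_indicator_map_sub _ y R F
    rw [lintegral_congr_ae hae]
    exact lintegral_lintegral_indicator_ball_div hδ hsep R fun y =>
      (hF.comp measurable_prodMk_left).comp (measurable_sub_const y)
  rw [← lintegral_congr_ae (hcore.mono fun μ hμ => hsent μ hμ), key]
  exact lintegral_congr_ae (hcore.mono fun μ hμ => hrec μ hμ)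

end Transport

end Summit.AtomisticToContinuum.Crystallization.Theorems.UnimodularEnergy

end
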